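import Summits.QuantumFields.QCD.Theorems.QuarksNoInfraredClauseTorusHalfSpectrumStubGammaFiveConjExpectAux
import Literature.MathematicalPhysics.QuantumFieldTheory.QCDPropagatorParity
import HarnessLib

/-!
# Crux `TorusHalfSpectrum` (stmt-QuantumFields-9508), line `registered` (`Lines/birth.lean`, reshape v6) —
# stub `stub_gammaFiveConj_expect` (K1): `γ₅`-conjugation symmetry of the statement's torus functional

Stub K1 of the birth skeleton of the crux
`Summit.QuantumFields.QCD.Theses.QuarksNoInfraredClause.TorusHalfSpectrum`: every `γ₅`-conjugation `K`
of the torus quark Grassmann algebra `FermiAlg Nf S` (a multiplicative, additive, antilinear, unital map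
with `K ψ_{f,x,a,α} = −∑_σ (γ₅)_{σα} ψ̄_{f,x,a,σ}`, `K ψ̄_{f,x,a,α} = ∑_σ (γ₅)_{ασ} ψ_{f,x,a,σ}` — the six
CLAUSES of the skeleton's `IsGammaFiveConj K`)

1. FIXES the periodic Wilson quark Boltzmann factor, `K e^{−ψ̄D(U)ψ} = e^{−ψ̄D(U)ψ}` for every `SU(3)`
   gauge field `U` and all bare masses, and
2. CONJUGATES the honest signed torus functional of the statement,
   `⟨K ∘ X⟩_{β,S,m} = conj ⟨X⟩_{β,S,m}` for every Grassmann-valued `X`, every `β`, all masses.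

How.  Every `γ₅`-conjugation IS the Literature `torusK = Λ(K₀) ∘ conj` (`eq_torusK_of_clauses`, stub
K0's file), so it suffices to treat `torusK`:
* `torusK (ψ̄Aψ) = ψ̄ A^K ψ` with `A^K = kMatrix A` (`torusK_quadratic`, Aux file) and `torusK` of an
  exponential is the exponential (`torusK_grassmannExp`);
* **`(D(U))^K = D(U)`** (`kMatrix_diracMatrix`): `γ₅`-hermiticity `γ₅ D_W γ₅ = D_W†` of the Wilson–Dirac
  operator (tree `wilsonDirac_gammaFive_hermitian_holds`, Montvay–Münster (4.35)), in the entrywise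
  flavour-diagonal form `ε_p D_{pq} ε_q = conj D_{qp}`, `ε = (1,1,−1,−1)` at the spin of the index
  (`diracMatrix_signConj`), together with `γ₅ = diag ε` (`gammaFive_eq_diagonal`) collapsing the two spin
  sums of `kMatrix`;
* hence `torusK e^{−ψ̄D(U)ψ} = e^{−ψ̄D(U)ψ}` (`torusK_fermiBoltzmann`);
* `∫dψ̄dψ ∘ K = det K₀ · conj ∘ ∫dψ̄dψ` (`fermiIntegral_torusK`) and `∫ conj = conj ∫` give
  `N' = det K₀ · conj N` for the numerator of `⟨K∘X⟩` (`K(X)·e^{−S} = K(X·e^{−S})`) and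
  `D = det K₀ · conj D` for the common denominator, whence `N'/D = conj (N/D)`
  (`div_eq_conj_div_of_eq_mul_conj`; the Jacobian cancels whatever its value, junk `0/0` included).

Everything used is proved in the tree (no named fact).  Sources: I. Montvay, G. Münster, *Quantum Fields
on a Lattice* (CUP 1994) §4.2 (4.35) (`γ₅`-hermiticity), §5.1.2 (5.15)–(5.16) (reality of the quark
determinant / conjugate correlators); the packaging as an antilinear Grassmann ring map is folklore.
-/

noncomputable section

namespace Summit.QuantumFields.QCD.Cruxes.TorusHalfSpectrum.Birth.GammaFiveConjExpect

open scoped BigOperators ComplexConjugate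
open MeasureTheory
open Literature.Probability.LatticeModels Literature.MathematicalPhysics.QuantumFieldTheory
  Literature.MathematicalPhysics.QuantumLattice
open Summit.QuantumFields.QCD.Cruxes.TorusHalfSpectrum.Birth.GammaFiveConjExists

variable {Nf L : ℕ} [NeZero L]

/-! ### `γ₅`-hermiticity: `(D(U))^K = D(U)` -/

/-- Replacing the spin of a quark index by its own spin does nothing. [folklore] -/
theorem kSpinIdx_self (p : FermiIdx Nf L) : kSpinIdx p (quarkEquiv.symm p).2.2.2 = p := by
  obtain ⟨⟨f, x, a, α⟩, rfl⟩ := quarkEquiv.surjective p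
  simp

/-- **`γ₅`-hermiticity of the `N_f`-flavour Wilson matrix, entrywise**:
`conj D_{qp} = ε_{σ_p} D_{pq} ε_{σ_q}` with `ε = (1, 1, −1, −1)` (`diracMatrix_signConj`, i.e.
`wilsonDirac_gammaFive_hermitian_holds` flavour by flavour). [cite: MontvayMunster1994, §4.2 (4.35)] -/
theorem star_diracMatrix_apply (U : GaugeConfig 4 L (Matrix.specialUnitaryGroup (Fin 3) ℂ))
    (mq : Fin Nf → ℝ) (p q : FermiIdx Nf L) :
    star (diracMatrix U mq q p) =
      (![1, 1, -1, -1] : Fin 4 → ℂ) (quarkEquiv.symm p).2.2.2 * diracMatrix U mq p q *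
        (![1, 1, -1, -1] : Fin 4 → ℂ) (quarkEquiv.symm q).2.2.2 := by
  have h := congr_fun (congr_fun (diracMatrix_signConj U mq) p) q
  rw [Matrix.mul_diagonal, Matrix.diagonal_mul, Matrix.conjTranspose_apply] at h
  exact h.symm

/-- **`(D(U))^K = D(U)`**: the `K`-conjugate `γ₅ D† γ₅` (blockwise) of the periodic `N_f`-flavour
Wilson–Dirac matrix is the matrix itself — `γ₅`-hermiticity (Montvay–Münster (4.35)); with
`γ₅ = diag(1,1,−1,−1)` the two spin sums of `kMatrix` collapse and `ε² = 1`. [cite: MontvayMunster1994, §4.2 (4.35)] -/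
theorem kMatrix_diracMatrix (U : GaugeConfig 4 L (Matrix.specialUnitaryGroup (Fin 3) ℂ))
    (mq : Fin Nf → ℝ) : kMatrix (diracMatrix U mq) = diracMatrix U mq := by
  ext p q
  change ∑ α : Fin 4, ∑ β : Fin 4, gammaFive (quarkEquiv.symm p).2.2.2 β *
      star (diracMatrix U mq (kSpinIdx q α) (kSpinIdx p β)) *
        gammaFive α (quarkEquiv.symm q).2.2.2 = diracMatrix U mq p q
  rw [Fintype.sum_eq_single (quarkEquiv.symm q).2.2.2 ?_,
    Fintype.sum_eq_single (quarkEquiv.symm p).2.2.2 ?_]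
  · -- the surviving term: `ε_p (ε_p D_{pq} ε_q) ε_q = D_{pq}`
    rw [kSpinIdx_self, kSpinIdx_self, star_diracMatrix_apply U mq p q, gammaFive_eq_diagonal,
      Matrix.diagonal_apply_eq, Matrix.diagonal_apply_eq]
    have hp := gammaFiveSign_mul_self (quarkEquiv.symm p).2.2.2
    have hq := gammaFiveSign_mul_self (quarkEquiv.symm q).2.2.2
    calc (![1, 1, -1, -1] : Fin 4 → ℂ) (quarkEquiv.symm p).2.2.2 *
          ((![1, 1, -1, -1] : Fin 4 → ℂ) (quarkEquiv.symm p).2.2.2 * diracMatrix U mq p q *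
            (![1, 1, -1, -1] : Fin 4 → ℂ) (quarkEquiv.symm q).2.2.2) *
          (![1, 1, -1, -1] : Fin 4 → ℂ) (quarkEquiv.symm q).2.2.2
        = (![1, 1, -1, -1] : Fin 4 → ℂ) (quarkEquiv.symm p).2.2.2 *
            (![1, 1, -1, -1] : Fin 4 → ℂ) (quarkEquiv.symm p).2.2.2 * diracMatrix U mq p q *
            ((![1, 1, -1, -1] : Fin 4 → ℂ) (quarkEquiv.symm q).2.2.2 *
              (![1, 1, -1, -1] : Fin 4 → ℂ) (quarkEquiv.symm q).2.2.2) := by ring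
      _ = diracMatrix U mq p q := by rw [hp, hq, one_mul, mul_one]
  · -- `β ≠ σ_p`: the factor `(γ₅)_{σ_p β}` vanishes
    intro β hβ
    rw [gammaFive_eq_diagonal, Matrix.diagonal_apply_ne _ (Ne.symm hβ), zero_mul, zero_mul]
  · -- `α ≠ σ_q`: the factor `(γ₅)_{α σ_q}` vanishes
    intro α hα
    rw [gammaFive_eq_diagonal, Matrix.diagonal_apply_ne _ hα]
    simp only [mul_zero, Finset.sum_const_zero]

/-! ### `K` fixes the Boltzmann factor and conjugates the functional -/

/-- **`K e^{−ψ̄D(U)ψ} = e^{−ψ̄D(U)ψ}`**: the Literature `γ₅`-conjugation fixes the periodic Wilson quark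
Boltzmann factor (`K exp = exp K`, `K(ψ̄Aψ) = ψ̄A^Kψ`, `(−D)^K = −D^K = −D`). [cite: MontvayMunster1994, §5.1.2 (5.15)] -/
theorem torusK_fermiBoltzmann (U : GaugeConfig 4 L (Matrix.specialUnitaryGroup (Fin 3) ℂ))
    (mq : Fin Nf → ℝ) : torusK (fermiBoltzmann U mq) = fermiBoltzmann U mq := by
  rw [fermiBoltzmann, torusK_grassmannExp (isNilpotent_quadratic ℂ _), torusK_quadratic, kMatrix_neg,
    kMatrix_diracMatrix]

/-- **`⟨K ∘ X⟩ = conj ⟨X⟩` for the Literature `γ₅`-conjugation**: numerator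
`∫dμ_W ∫dψ̄dψ K(X)e^{−S} = ∫dμ_W ∫dψ̄dψ K(X e^{−S}) = det K₀ · conj N` and denominator `D = det K₀ · conj D`,
so the ratio is conjugated (junk `0/0` on both sides otherwise). [cite: MontvayMunster1994, §5.1.2 (5.15)–(5.16)] -/
theorem qcdTorusExpect_torusK (β : ℝ) (mq : Fin Nf → ℝ)
    (X : GaugeConfig 4 L (Matrix.specialUnitaryGroup (Fin 3) ℂ) → FermiAlg Nf L) :
    qcdTorusExpect β L mq (fun U => torusK (X U)) = starRingEnd ℂ (qcdTorusExpect β L mq X) := by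
  unfold qcdTorusExpect
  refine div_eq_conj_div_of_eq_mul_conj (c := kBerezinConst Nf L) ?_ ?_
  · refine (integral_congr_ae (Filter.Eventually.of_forall fun U => ?_)).trans
      (integral_fermiIntegral_torusK _ fun U => X U * fermiBoltzmann U mq)
    simp only [torusK_mul, torusK_fermiBoltzmann]
  · refine (integral_congr_ae (Filter.Eventually.of_forall fun U => ?_)).trans
      (integral_fermiIntegral_torusK _ fun U => fermiBoltzmann U mq)
    simp only [torusK_fermiBoltzmann]

/-! ### The registered stub -/

/-- **Stub K1 of the birth skeleton of `TorusHalfSpectrum` (= `ConjugationExpectStmt` unfolded):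
`γ₅`-conjugation symmetry of the statement's torus functional.**  Any `γ₅`-conjugation `K` agrees with
`torusK` (`eq_torusK_of_clauses`, uniqueness from the six clauses by `ExteriorAlgebra.induction`);
`torusK` fixes the periodic Wilson quark Boltzmann factor (`torusK_fermiBoltzmann`: `γ₅`-hermiticity
`wilsonDirac_gammaFive_hermitian_holds` through `kMatrix_diracMatrix`) and conjugates the functional
(`qcdTorusExpect_torusK`: `∫dψ̄dψ ∘ K = det K₀ · conj ∘ ∫dψ̄dψ`, `∫ conj = conj ∫`, the constant cancels in
the ratio). -/
theorem stub_gammaFiveConj_expect :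
    ∀ (Nf S : ℕ) [NeZero S] (K : FermiAlg Nf S → FermiAlg Nf S),
      ((∀ x y, K (x * y) = K x * K y) ∧ (∀ x y, K (x + y) = K x + K y) ∧
        (∀ (c : ℂ) (x : FermiAlg Nf S), K (c • x) = starRingEnd ℂ c • K x) ∧ K 1 = 1 ∧
        (∀ v : QuarkVar Nf S, K (_root_.Literature.MathematicalPhysics.QuantumFieldTheory.q v) =
          -∑ σ : Fin 4, _root_.Literature.MathematicalPhysics.QuantumLattice.gammaFive σ v.2.2.2 •
            _root_.Literature.MathematicalPhysics.QuantumFieldTheory.qbar (v.1, (v.2.1, v.2.2.1, σ))) ∧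
        (∀ v : QuarkVar Nf S, K (_root_.Literature.MathematicalPhysics.QuantumFieldTheory.qbar v) =
          ∑ σ : Fin 4, _root_.Literature.MathematicalPhysics.QuantumLattice.gammaFive v.2.2.2 σ •
            _root_.Literature.MathematicalPhysics.QuantumFieldTheory.q (v.1, (v.2.1, v.2.2.1, σ)))) →
      (∀ (U : GaugeConfig 4 S (Matrix.specialUnitaryGroup (Fin 3) ℂ)) (mq : Fin Nf → ℝ),
          K (fermiBoltzmann U mq) = fermiBoltzmann U mq) ∧
        ∀ (β : ℝ) (mq : Fin Nf → ℝ)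
          (X : GaugeConfig 4 S (Matrix.specialUnitaryGroup (Fin 3) ℂ) → FermiAlg Nf S),
          qcdTorusExpect β S mq (fun U => K (X U)) = starRingEnd ℂ (qcdTorusExpect β S mq X) := by
  intro Nf S _ K hK
  obtain ⟨hmul, hadd, hsmul, hone, hq, hqbar⟩ := hK
  have hKt : ∀ a, K a = torusK a := eq_torusK_of_clauses hmul hadd hsmul hone hq hqbar
  refine ⟨fun U mq => ?_, fun β mq X => ?_⟩
  · rw [hKt, torusK_fermiBoltzmann]
  · have hX : (fun U => K (X U)) = fun U => torusK (X U) := funext fun U => hKt (X U)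
    rw [hX, qcdTorusExpect_torusK]

end Summit.QuantumFields.QCD.Cruxes.TorusHalfSpectrum.Birth.GammaFiveConjExpect

end
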